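import Literature.Analysis.SpecialFunctions.InvSinhEulerMascheroni
import Mathlib.Analysis.SpecialFunctions.Gaussian.GaussianIntegral
import HarnessLib

/-!
# `∫₀^∞ (e^{−a u²}/u − 1/sinh u) du = −(γ + log a)/2 − log 2` and `∫₀^∞ (e^{−u} − e^{−a u²}) du/u = (log a − γ)/2`

LABEL (line 1): RH-FREE classical analysis (Euler's constant, the exponential integral `E₁`); part (C) of the
discharge of the named fact `Literature.NumberTheory.LFunctions.Connes2024_heat_thm_1_1` (Connes 2024 Thm 1.1,
CONDITIONAL ON RH as printed; `ZetaHeatExpansion.lean`).  Cell `rh-crit`, sub-cell `cc/`, row O1.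
bears_on: W-C/W-P (C1) record only.  WHAT THIS IS NOT: anything about `ζ` or bearing on the truth of RH.

This is the constant in the archimedean term of the explicit formula for the Gaussian test function
`F_t(e^u) = e^{−u²/4t}/(2√π√t)` (A. Connes, *Heat expansion and zeta*, arXiv:2402.13082 = Ann. Funct. Anal. 15
(2024), §3 [bib `Connes2024HeatExpansion`, held text `paper:arxiv-2402.13082` p0005–p0006]): Bombieri's
archimedean term is `−(log 4π + γ)F(1) − ∫₀^∞ (2F(e^u) e^{u/2} − 2F(1))/(2 sinh u) du`, and after the printed
split `e^{u/2}/(e^u − e^{−u}) = r(u) + 1/(2u)` the `F(1)`-part of the integral is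
`F_t(1)·∫₀^∞ (e^{−u²/4t}/u − 1/sinh u) du`, which the source evaluates through
"`∫₀^a (1 − e^{−u})/u du = log a + Γ(0,a) + γ`" and "`∫₀² (e^{−y²/4t} − 1)/y dy = −½(log(1/t) + Γ(0,1/t) + γ)`"
(p0006:L1–L12) to the printed `(−log(1/t) − γ)/(4√π√t) + (log 4π + γ)/(2√π√t)` up to `O(t^∞)`.  Here the same
constant is obtained EXACTLY (no `O(t^∞)`), in the form the assembly uses:

* `integral_exp_neg_sub_exp_neg_mul_sq_div` — `∫₀^∞ (e^{−u} − e^{−a u²})/u du = (log a − γ)/2` (`a > 0`):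
  antiderivative `½E₁(a u²) − E₁(u)`, limits from the tree's `E₁ = Ein − γ − log`
  (`Literature.NumberTheory.Sieve.ein_eq_add`) and `E₁(∞) = 0`;
* `integral_exp_neg_mul_sq_div_sub_inv_sinh` — `∫₀^∞ (e^{−a u²}/u − 1/sinh u) du = −(γ + log a)/2 − log 2`, adding
  the tree's `∫₀^∞ (1/sinh u − e^{−u}/u) du = γ + log 2` (`integral_inv_sinh_sub_exp_neg_div`);
* `integral_exp_neg_sq_div_sub_inv_sinh` — the case `a = 1/(4t)`: `∫₀^∞ (e^{−u²/(4t)}/u − 1/sinh u) du = (log t − γ)/2`.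
-/

noncomputable section

open Real Filter Set MeasureTheory Topology

namespace Literature.Analysis.SpecialFunctions

open Literature.NumberTheory.Sieve

/-! ### `∫₀^∞ (e^{−u} − e^{−a u²}) du/u` -/

/-- The integrand `(e^{−u} − e^{−a u²})/u` is continuous on `(0, ∞)`. [folklore] -/
private theorem continuousOn_expDiff {a : ℝ} :
    ContinuousOn (fun u : ℝ ↦ (Real.exp (-u) - Real.exp (-(a * u ^ 2))) / u) (Ioi 0) := by
  refine ContinuousOn.div ?_ continuousOn_id fun u (hu : 0 < u) ↦ hu.ne'
  fun_prop

/-- Pointwise bound: `|(e^{−u} − e^{−a u²})/u| ≤ 1 + a u` for `u > 0`, `a ≥ 0` (`1 − e^{−x} ≤ x`). [folklore] -/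
private theorem abs_expDiff_le {a u : ℝ} (ha : 0 ≤ a) (hu : 0 < u) :
    |(Real.exp (-u) - Real.exp (-(a * u ^ 2))) / u| ≤ 1 + a * u := by
  rw [abs_div, abs_of_pos hu, div_le_iff₀ hu]
  have h1 : |Real.exp (-u) - 1| ≤ u := by
    rw [abs_sub_comm, abs_of_nonneg (by rw [sub_nonneg, Real.exp_le_one_iff]; linarith)]
    linarith [Real.add_one_le_exp (-u)]
  have h2 : |1 - Real.exp (-(a * u ^ 2))| ≤ a * u ^ 2 := by
    rw [abs_of_nonneg (by rw [sub_nonneg, Real.exp_le_one_iff]; nlinarith)]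
    linarith [Real.add_one_le_exp (-(a * u ^ 2))]
  calc |Real.exp (-u) - Real.exp (-(a * u ^ 2))|
      = |(Real.exp (-u) - 1) + (1 - Real.exp (-(a * u ^ 2)))| := by ring_nf
    _ ≤ |Real.exp (-u) - 1| + |1 - Real.exp (-(a * u ^ 2))| := abs_add_le _ _
    _ ≤ u + a * u ^ 2 := add_le_add h1 h2
    _ = (1 + a * u) * u := by ring

/-- **Integrability** of `(e^{−u} − e^{−a u²})/u` on `(0, ∞)` for `a > 0` (bounded near `0`, exponentially small
at infinity). [folklore] -/
private theorem integrableOn_expDiff {a : ℝ} (ha : 0 < a) :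
    IntegrableOn (fun u : ℝ ↦ (Real.exp (-u) - Real.exp (-(a * u ^ 2))) / u) (Ioi 0) := by
  rw [← Ioc_union_Ioi_eq_Ioi zero_le_one, integrableOn_union]
  constructor
  · -- on `(0, 1]`: bounded by `1 + a`
    have hmeas : AEStronglyMeasurable (fun u : ℝ ↦ (Real.exp (-u) - Real.exp (-(a * u ^ 2))) / u)
        (volume.restrict (Ioc 0 1)) :=
      (continuousOn_expDiff.mono Ioc_subset_Ioi_self).aestronglyMeasurable measurableSet_Ioc
    refine Integrable.mono' (g := fun _ ↦ 1 + a) ?_ hmeas ?_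
    · exact integrableOn_const (by simp [Real.volume_Ioc])
    · refine (ae_restrict_iff' measurableSet_Ioc).2 (Eventually.of_forall fun u hu ↦ ?_)
      rw [Real.norm_eq_abs]
      calc _ ≤ 1 + a * u := abs_expDiff_le ha.le hu.1
        _ ≤ 1 + a := by nlinarith [hu.2]
  · -- on `(1, ∞)`: bounded by `e^{−u} + e^{−a u}`
    have hmeas : AEStronglyMeasurable (fun u : ℝ ↦ (Real.exp (-u) - Real.exp (-(a * u ^ 2))) / u)
        (volume.restrict (Ioi 1)) :=
      (continuousOn_expDiff.mono (Ioi_subset_Ioi zero_le_one)).aestronglyMeasurable measurableSet_Ioi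
    have hg := (exp_neg_integrableOn_Ioi 1 one_pos).add (exp_neg_integrableOn_Ioi 1 ha)
    refine Integrable.mono' hg hmeas ?_
    refine (ae_restrict_iff' measurableSet_Ioi).2 (Eventually.of_forall fun u (hu : 1 < u) ↦ ?_)
    rw [Real.norm_eq_abs, abs_div, abs_of_pos (by linarith : (0 : ℝ) < u), Pi.add_apply]
    have hu0 : (0 : ℝ) < u := by linarith
    calc |Real.exp (-u) - Real.exp (-(a * u ^ 2))| / u
        ≤ |Real.exp (-u) - Real.exp (-(a * u ^ 2))| / 1 :=
          div_le_div_of_nonneg_left (abs_nonneg _) one_pos hu.le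
      _ ≤ Real.exp (-u) + Real.exp (-(a * u ^ 2)) := by
          rw [div_one]
          exact (abs_sub _ _).trans (by rw [abs_of_pos (Real.exp_pos _), abs_of_pos (Real.exp_pos _)])
      _ ≤ Real.exp (-1 * u) + Real.exp (-a * u) := by
          rw [neg_one_mul]
          gcongr
          have : a * u ≤ a * u ^ 2 :=
            mul_le_mul_of_nonneg_left (le_self_pow₀ hu.le two_ne_zero) ha.le
          linarith

/-- The antiderivative: for `u > 0`, `d/du [½ E₁(a u²) − E₁(u)] = (e^{−u} − e^{−a u²})/u` (`a > 0`). [folklore] -/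
private theorem hasDerivAt_antiderivG {a u : ℝ} (ha : 0 < a) (hu : 0 < u) :
    HasDerivAt (fun v : ℝ ↦ 1 / 2 * expIntegralE1 (a * v ^ 2) - expIntegralE1 v)
      ((Real.exp (-u) - Real.exp (-(a * u ^ 2))) / u) u := by
  have hau : 0 < a * u ^ 2 := by positivity
  have hin : HasDerivAt (fun v : ℝ ↦ a * v ^ 2) (a * (2 * u)) u := by
    have := (hasDerivAt_pow 2 u).const_mul a
    simpa using this
  have h1₀ := (hasDerivAt_expIntegralE1 hau).comp u hin
  have h1 : HasDerivAt (fun v : ℝ ↦ expIntegralE1 (a * v ^ 2))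
      (-(Real.exp (-(a * u ^ 2)) / (a * u ^ 2)) * (a * (2 * u))) u := h1₀
  have h2 := hasDerivAt_expIntegralE1 hu
  refine ((h1.const_mul (1 / 2)).sub h2).congr_deriv ?_
  field_simp
  ring

/-- The antiderivative tends to `0` at `+∞`. [folklore] -/
private theorem tendsto_antiderivG_atTop {a : ℝ} (ha : 0 < a) :
    Tendsto (fun v : ℝ ↦ 1 / 2 * expIntegralE1 (a * v ^ 2) - expIntegralE1 v) atTop (𝓝 0) := by
  have hsq : Tendsto (fun v : ℝ ↦ a * v ^ 2) atTop atTop :=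
    (tendsto_pow_atTop two_ne_zero).const_mul_atTop ha
  have h1 := (tendsto_expIntegralE1_atTop.comp hsq).const_mul (1 / 2)
  have h := h1.sub tendsto_expIntegralE1_atTop
  simpa using h

/-- The antiderivative tends to `γ/2 − (log a)/2` at `0⁺` (`E₁ = Ein − γ − log`, `Ein(0) = 0`). [folklore] -/
private theorem tendsto_antiderivG_zero {a : ℝ} (ha : 0 < a) :
    Tendsto (fun v : ℝ ↦ 1 / 2 * expIntegralE1 (a * v ^ 2) - expIntegralE1 v) (𝓝[>] 0)
      (𝓝 (Real.eulerMascheroniConstant / 2 - Real.log a / 2)) := by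
  have hein0 : Tendsto ein (𝓝 0) (𝓝 0) := by
    have h0 := continuous_ein.tendsto 0
    rwa [ein_zero] at h0
  have hsq : Tendsto (fun v : ℝ ↦ a * v ^ 2) (𝓝[>] (0 : ℝ)) (𝓝 0) := by
    have : Tendsto (fun v : ℝ ↦ a * v ^ 2) (𝓝 0) (𝓝 (a * 0 ^ 2)) :=
      (continuous_const.mul (continuous_pow 2)).tendsto 0
    simp only [zero_pow two_ne_zero, mul_zero] at this
    exact this.mono_left nhdsWithin_le_nhds
  have hein1 : Tendsto (fun v : ℝ ↦ ein (a * v ^ 2)) (𝓝[>] 0) (𝓝 0) := hein0.comp hsq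
  have hein2 : Tendsto ein (𝓝[>] 0) (𝓝 0) := hein0.mono_left nhdsWithin_le_nhds
  have h := ((hein1.const_mul (1 / 2)).sub hein2).add
    (tendsto_const_nhds (x := Real.eulerMascheroniConstant / 2 - Real.log a / 2))
  have e : (1 / 2 : ℝ) * 0 - 0 + (Real.eulerMascheroniConstant / 2 - Real.log a / 2) =
      Real.eulerMascheroniConstant / 2 - Real.log a / 2 := by ring
  rw [e] at h
  refine h.congr' ?_
  filter_upwards [self_mem_nhdsWithin] with v (hv : 0 < v)
  have hav : 0 < a * v ^ 2 := by positivity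
  have hE1 : expIntegralE1 (a * v ^ 2) =
      ein (a * v ^ 2) - Real.eulerMascheroniConstant - Real.log (a * v ^ 2) := by
    linarith [ein_eq_add hav]
  have hE2 : expIntegralE1 v = ein v - Real.eulerMascheroniConstant - Real.log v := by
    linarith [ein_eq_add hv]
  rw [hE1, hE2, Real.log_mul ha.ne' (pow_ne_zero 2 hv.ne'), Real.log_pow]
  push_cast
  ring

/-- **`∫₀^∞ (e^{−u} − e^{−a u²})/u du = (log a − γ)/2`** for `a > 0` (antiderivative `½E₁(au²) − E₁(u)`; the case
`a = 1`, `∫₀^∞ (e^{−u} − e^{−u²}) du/u = −γ/2`, is the classical companion of Euler's `∫₀^∞ e^{−u} log u du = −γ`).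
[cite: Connes2024HeatExpansion, §3, displays `∫₀^a (1−e^{−u})/u du = log a + Γ(0,a) + γ` and the next (arXiv p0006:L1–L9)] -/
theorem integral_exp_neg_sub_exp_neg_mul_sq_div {a : ℝ} (ha : 0 < a) :
    ∫ u in Ioi (0 : ℝ), (Real.exp (-u) - Real.exp (-(a * u ^ 2))) / u =
      (Real.log a - Real.eulerMascheroniConstant) / 2 := by
  set f : ℝ → ℝ := fun u ↦ (Real.exp (-u) - Real.exp (-(a * u ^ 2))) / u with hf
  set Φ : ℝ → ℝ := fun v ↦ 1 / 2 * expIntegralE1 (a * v ^ 2) - expIntegralE1 v with hΦ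
  set L : ℝ := Real.eulerMascheroniConstant / 2 - Real.log a / 2 with hL
  have hfi : IntegrableOn f (Ioi 0) := integrableOn_expDiff ha
  set Ψ : ℝ → ℝ := Function.update Φ 0 L with hΨ
  have hΨeq : ∀ u : ℝ, 0 < u → Ψ u = Φ u := fun u hu ↦ by simp [hΨ, hu.ne']
  have hFTC : ∀ R : ℝ, 0 < R → ∫ t in (0 : ℝ)..R, f t = Φ R - L := by
    intro R hR
    have hcont : ContinuousOn Ψ (Icc 0 R) := by
      intro x hx
      rcases eq_or_lt_of_le hx.1 with h0 | h0
      · rw [← h0]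
        refine (continuousWithinAt_update_same).2 ?_
        exact (tendsto_antiderivG_zero ha).mono_left (nhdsWithin_mono _ fun y hy ↦ by
          rcases hy with ⟨hy1, hy2⟩
          exact lt_of_le_of_ne hy1.1 (Ne.symm hy2))
      · have hd := (hasDerivAt_antiderivG ha h0).continuousAt
        refine (hd.continuousWithinAt.congr_of_eventuallyEq ?_ (hΨeq x h0))
        filter_upwards [mem_nhdsWithin_of_mem_nhds (Ioi_mem_nhds h0)] with y hy using hΨeq y hy
    have hderiv : ∀ x ∈ Ioo 0 R, HasDerivAt Ψ (f x) x := by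
      intro x hx
      refine (hasDerivAt_antiderivG ha hx.1).congr_of_eventuallyEq ?_
      filter_upwards [Ioi_mem_nhds hx.1] with y hy using hΨeq y hy
    have hint : IntervalIntegrable f volume 0 R := by
      refine (intervalIntegrable_iff_integrableOn_Ioc_of_le hR.le).2 ?_
      exact hfi.mono_set Ioc_subset_Ioi_self
    have h := intervalIntegral.integral_eq_sub_of_hasDerivAt_of_le hR.le hcont hderiv hint
    rw [h, hΨeq R hR]
    simp [hΨ]
  have h1 : Tendsto (fun R : ℝ ↦ ∫ t in (0 : ℝ)..R, f t) atTop (𝓝 (∫ t in Ioi 0, f t)) :=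
    intervalIntegral_tendsto_integral_Ioi 0 hfi tendsto_id
  have h2 : Tendsto (fun R : ℝ ↦ ∫ t in (0 : ℝ)..R, f t) atTop (𝓝 (0 - L)) := by
    refine ((tendsto_antiderivG_atTop ha).sub tendsto_const_nhds).congr' ?_
    filter_upwards [eventually_gt_atTop (0 : ℝ)] with R hR
    exact (hFTC R hR).symm
  have := tendsto_nhds_unique h1 h2
  rw [this, hL]
  ring

/-! ### `∫₀^∞ (e^{−a u²}/u − 1/sinh u) du` -/

/-- **Integrability** of `e^{−a u²}/u − 1/sinh u` on `(0, ∞)` (`a > 0`): the `F(1)`-part of the archimedean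
integral of the explicit formula for the Gaussian converges absolutely.
[cite: Connes2024HeatExpansion, §3, display for `W_ℝ(F_t)` (arXiv p0005:L14) and its evaluation (p0006:L10–L12)] -/
theorem integrableOn_exp_neg_mul_sq_div_sub_inv_sinh {a : ℝ} (ha : 0 < a) :
    IntegrableOn (fun u : ℝ ↦ Real.exp (-(a * u ^ 2)) / u - 1 / Real.sinh u) (Ioi 0) := by
  have h := (integrableOn_inv_sinh_sub_exp_neg_div.neg).sub (integrableOn_expDiff ha)
  have e : (fun u : ℝ ↦ Real.exp (-(a * u ^ 2)) / u - 1 / Real.sinh u) =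
      (-fun t : ℝ ↦ 1 / Real.sinh t - Real.exp (-t) / t) -
        fun u : ℝ ↦ (Real.exp (-u) - Real.exp (-(a * u ^ 2))) / u := by
    funext u
    simp only [Pi.sub_apply, Pi.neg_apply]
    ring
  rw [e]
  exact h

/-- **`∫₀^∞ (e^{−a u²}/u − 1/sinh u) du = −(γ + log a)/2 − log 2`** (`a > 0`): the tree's
`∫₀^∞ (1/sinh u − e^{−u}/u) du = γ + log 2` plus `integral_exp_neg_sub_exp_neg_mul_sq_div`.
[cite: Connes2024HeatExpansion, §3, the evaluation of `(log 4π+γ)F_t(1) + ∫₀² (F_t(e^u)−F_t(1))/u du` (arXiv p0006:L10–L12)] -/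
theorem integral_exp_neg_mul_sq_div_sub_inv_sinh {a : ℝ} (ha : 0 < a) :
    ∫ u in Ioi (0 : ℝ), (Real.exp (-(a * u ^ 2)) / u - 1 / Real.sinh u) =
      -(Real.eulerMascheroniConstant + Real.log a) / 2 - Real.log 2 := by
  have hi1 : IntegrableOn (fun u : ℝ ↦ -(1 / Real.sinh u - Real.exp (-u) / u)) (Ioi 0) :=
    integrableOn_inv_sinh_sub_exp_neg_div.neg
  have hi2 := integrableOn_expDiff ha
  have e : (fun u : ℝ ↦ Real.exp (-(a * u ^ 2)) / u - 1 / Real.sinh u) =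
      fun u ↦ -(1 / Real.sinh u - Real.exp (-u) / u) - (Real.exp (-u) - Real.exp (-(a * u ^ 2))) / u := by
    funext u; ring
  rw [e, integral_sub hi1 hi2, integral_neg, integral_inv_sinh_sub_exp_neg_div,
    integral_exp_neg_sub_exp_neg_mul_sq_div ha]
  ring

/-- **The case `a = 1/(4t)`**: `∫₀^∞ (e^{−u²/(4t)}/u − 1/sinh u) du = (log t − γ)/2` for `t > 0` — the constant
of the archimedean term for the heat test function `F_t(e^u) = e^{−u²/4t}/(2√π√t)`.
[cite: Connes2024HeatExpansion, §3, display (arXiv p0006:L10–L12): `(log 4π+γ)F_t(1) + ∫₀²(F_t(e^u)−F_t(1))/u du = (−log(1/t)−γ)/(4√π√t) + (log 4π+γ)/(2√π√t) + O(t^∞)`] -/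
theorem integral_exp_neg_sq_div_sub_inv_sinh {t : ℝ} (ht : 0 < t) :
    ∫ u in Ioi (0 : ℝ), (Real.exp (-u ^ 2 / (4 * t)) / u - 1 / Real.sinh u) =
      (Real.log t - Real.eulerMascheroniConstant) / 2 := by
  have ha : 0 < 1 / (4 * t) := by positivity
  have e : (fun u : ℝ ↦ Real.exp (-u ^ 2 / (4 * t)) / u - 1 / Real.sinh u) =
      fun u ↦ Real.exp (-(1 / (4 * t) * u ^ 2)) / u - 1 / Real.sinh u := by
    funext u; congr 3; field_simp
  rw [e, integral_exp_neg_mul_sq_div_sub_inv_sinh ha, one_div, Real.log_inv,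
    Real.log_mul (by norm_num) ht.ne', show (4 : ℝ) = 2 ^ 2 by norm_num, Real.log_pow]
  push_cast
  ring

/-- Integrability in the `a = 1/(4t)` normalisation (the heat test function `F_t(e^u) = e^{−u²/4t}/(2√π√t)`).
[cite: Connes2024HeatExpansion, §3, display for `W_ℝ(F_t)` (arXiv p0005:L14) and its evaluation (p0006:L10–L12)] -/
theorem integrableOn_exp_neg_sq_div_sub_inv_sinh {t : ℝ} (ht : 0 < t) :
    IntegrableOn (fun u : ℝ ↦ Real.exp (-u ^ 2 / (4 * t)) / u - 1 / Real.sinh u) (Ioi 0) := by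
  have ha : 0 < 1 / (4 * t) := by positivity
  have e : (fun u : ℝ ↦ Real.exp (-u ^ 2 / (4 * t)) / u - 1 / Real.sinh u) =
      fun u ↦ Real.exp (-(1 / (4 * t) * u ^ 2)) / u - 1 / Real.sinh u := by
    funext u; congr 3; field_simp
  rw [e]
  exact integrableOn_exp_neg_mul_sq_div_sub_inv_sinh ha

end Literature.Analysis.SpecialFunctions

end
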